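/-
Copyright: the b2b-balaban T⁴-continuum CRUX team, row NE7b owner lineage `t4-ne7b-p1` (gen 112). Project licence.
-/
import Literature.MathematicalPhysics.QuantumFieldTheory.Balaban1983to89.B6QGQFourier275Zd
import Summits.QuantumFields.BalabanUV.T4Continuum.Spine.NE7b.OneShotChartFibreBound

/-!
# THE ONE-SHOT CHART OF THE FREE FIELD, FIBRE SUM: over the `N^d` block offsets `τ`, the (2.48) multipliers
# `G_τ(p′) = Σ_k e^{i(p′+2πk)·τ/N} u(p′+2πk) R_k(p′)/E(p′)` of `G′Q′*` have `Σ_τ |G_τ(p′)|² = N^d Σ_k U_k R_k²/E²`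
# (Parseval over the offsets), the CENTRAL alias has the largest `R` (`R_k ≤ 1 = R_0` on the zone), hence with
# (39) `fibre_bound`: `Σ_τ |G_τ(p′)|² ≤ N^d (π²∕4)^d · ((Q′G′Q′*)~(p′))²` on the real zone — every block side `N ≥ 1`,
# every `a > 0` (row NE7b, node U5c; Literature B4∕B6 columns + Mathlib + (39); [folklore] finite Fourier analysis)

Cell `pub-balaban`, sub-cell `t4`, spine estimate NE7b (`T4WeightBudget.RelWeightBound`; the cell's OWN estimate — NOT PRINTED in
[Bałaban 1983–89], NOT PROVED).  Crux-route work under `Spine/NE7b/` by the row OWNER (`t4-ne7b-p1` gen 112) under FREEZE (0)'s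
crux-prover clause (RULING W-ne7bp1-g112-1: the owner takes the PLANCHEREL JUNCTION of CLAIM C-ne7bp1-g111-1); NOTHING of Bałaban's is
asserted; no `T4Continuum/Support` leaf typed; no `def`; zero `sorry`.  Imports: `Literature…B6QGQFourier275Zd` (the scalar
whole-lattice `ℤ^d` column: `B4Strip`, `B4StripSums`, `B4Green244`, `B6QGQFourier275Zd`) and (39) `OneShotChartFibreBound`.

WHY.  CLAIM C-ne7bp1-g111-1 (journal [NE7bP1-G111-RULING3]): the `η`-norm of the one-shot free critical section `H_M` (block-mean
averaging of side `M = N`, massless scalar field on `ℤ^d`) is at most `(π∕2)^d`, by the fibre formula `M^{−d}‖H_M B‖² = ∫(S₂∕S²)|B̂|²`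
and the fibre bound `S₂ ≤ (π²∕4)^d S²` ((39), model-free).  This file is the FIBRE half of the junction for the tree's objects: the
multiplier of `G′Q′*` at block offset `τ` is `B4StripSums.G N a 0 τ` ((2.48) of [B4], regrouped: `Σ_k F_τ(k)R_k∕E`, `F_τ(k; p′) =
Π_ν e^{i(p′_ν+2πk_ν)τ_ν∕N} v_N(k_ν; p′_ν)`), and `(Q′G′Q′*)~ = symbR = X∕E` (`B6QGQFourier275Zd`, `X = Σ_k U_kR_k`, `E = aX + Δ₀`).
Summing `|G_τ|²` over the `N^d` offsets kills the cross terms between different aliases `k ≠ k′` (the offset phases are the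
characters of `(ℤ∕N)^d`), leaving `N^d Σ_k |u(p′+2πk)|² R_k²∕E²` — the numerator `S₂` of the desk's fibre formula in the tree's
letters (`U_k = |u|²`, `R_k = Δ₀∕Δ_k = X_k∕X_0`).  Step (2) of C-1 («the central alias has the largest `1∕Δ`») is `R_k ≤ 1`:
coordinatewise `4N²sin²((x+2πj)∕2N) ≥ 4N²sin²(x∕2N)` for `|x| ≤ π`, `1 ≤ j ≤ N−1`.

WHAT IS PROVED ([folklore]; `N ≥ 1` the block side, `a > 0`, `p ∈ [−π,π]^d`):
* §1 one coordinate on the real line: `conj_w`, **`conj_v`** (`conj v_N(j;x) = v̄_N(j;x)` = `B4Green244.vb`), **`norm_v_sq`**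
  (`‖v_N(j;x)‖² = uFactorr N j x = |u|²`'s factor, from `B4Green244.vb_mul_v_eq_uFactor`), `ef_mul_conj_ef`, **`sum_ef_mul_conj_ef`**
  (`Σ_{t<N} e^{i(x+2πj)t∕N} conj(e^{i(x+2πj′)t∕N}) = N·[j = j′]`, root-of-unity orthogonality `B4Green244.sum_rootOfUnity_pow`).
* §2 all coordinates: `sum_offsetPhase_mul_conj` (`Σ_τ Φ_k(τ) conj Φ_{k′}(τ) = N^d [k = k′]`), **`offset_parseval`**
  (`Σ_τ ‖Σ_k c_k Φ_k(τ)‖² = N^d Σ_k ‖c_k‖²` for any coefficients `c`).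
* §3 **`sum_normSq_G`**: `Σ_τ ‖G_{N,a,0,τ}(p)‖² = N^d (Σ_k U_k(p) R_k(p)²) ∕ E(p)²` (`norm_V_sq`: `‖V_k‖² = Ur N k`; `R`, `E` real on
  the zone).
* §4 **`Rr_le_one`**: `R_k(p) ≤ 1` on the zone (`Sxir_shift_ge`: `S_ξ(x + 2πj) ≥ S_ξ(x)`).
* §5 **`sum_Ur_mul_Rr_sq_le`** (`Σ_k U_kR_k² ≤ (π²∕4)^d X²`, (39) `fibre_bound` with `B4Strip.Ur_zero_ge`) and the headline
  **`sum_normSq_G_le`**: `Σ_τ ‖G_{N,a,0,τ}(p)‖² ≤ N^d (π²∕4)^d symbR(p)²`.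

NOT HERE (honest): the lattice-kernel ∕ Bessel bookkeeping turning this into `N^{−d}Σ_z (HB)(z)² ≤ (π²∕4)^d Σ_y B(y)²` for the tree's
`HBZd` (files (41)(42) of the road); anything of Bałaban's ((A3), NC-NE7b-α UNRULED).  BY-NAME EFFECT ON THE WALL: NONE.  NE7b NOT
PRINTED ∕ NOT PROVED; spine PROVED 0∕9; rung (B)+1 on a FINITE torus — NOT infinite volume, NOT the mass gap, NOT Clay.  HONEST
DEPENDENCY: continuum YM on T⁴ ⇐ BetaPertH ∧ nine spine estimates (0∕9 proved); BetaPertH ⇐ (D1) ∧ (D4) ∧ CAP+tail.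
-/

set_option autoImplicit false

namespace Summit.QuantumFields.BalabanUV.T4Continuum.NE7b.OneShotChartFibreSum

open Finset Complex
open Literature.MathematicalPhysics.QuantumFieldTheory.Balaban1983to89
open B4Strip (ofRealVec U Ur uFactor uFactorr E Er Sxir DeltaXir shiftr U_ofReal E_ofReal uFactor_ofReal Ur_nonneg
  Ur_zero_ge Er_ge Sxir_eq uFactorr_nonneg)
open B4StripSums (w v ef F R term G)
open B4Green244 (vb vb_mul_v_eq_uFactor V sum_rootOfUnity_pow)
open B4ContourShift (BZ)
open B6QGQFourier275Zd (Rr Xr symbR R_ofReal Rr_nonneg Er_eq Xr_nonneg)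
open OneShotChartFibreBound (fibre_bound)
open scoped Real ComplexConjugate

noncomputable section

variable {d : ℕ}

/-! ## §1. One coordinate, real momentum: `conj v = v̄`, `‖v‖² = |u|²`'s factor, offset orthogonality -/

/-- `conj w_N(j;x) = e^{i(x+2πj)∕N}` for real `x`. [folklore] -/
theorem conj_w (n j : ℕ) (x : ℝ) : conj (w n j x) = cexp ((((x + 2 * π * j) / n : ℝ) : ℂ) * I) := by
  unfold w
  have h : I * ((x : ℂ) + 2 * π * j) / n = (((x + 2 * π * j) / n : ℝ) : ℂ) * I := by push_cast; ring
  rw [h, ← Complex.exp_conj, map_neg, map_mul, Complex.conj_ofReal, Complex.conj_I, mul_neg, neg_neg]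

/-- **`conj v_N(j;x) = v̄_N(j;x)`** (`B4Green244.vb`) for real `x`. [folklore] -/
theorem conj_v (n j : ℕ) (x : ℝ) : conj (v n j x) = vb n j x := by
  unfold v vb
  rw [map_mul, map_inv₀, map_natCast, map_sum]
  congr 1
  refine Finset.sum_congr rfl fun s _ => ?_
  rw [map_pow, conj_w, ← Complex.exp_nat_mul]
  unfold ef
  congr 1
  push_cast; ring

/-- **`‖v_N(j;x)‖² = uFactorr N j x`** (`= S₁(x)∕S_ξ(x+2πj)`, the factor of `|u_j(p′+l)|²`) for `|x| ≤ π`, `j < N`, `1 ≤ N`.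
[folklore] -/
theorem norm_v_sq (n j : ℕ) (hn : 1 ≤ n) (hj : j < n) (x : ℝ) (hx : |x| ≤ π) : ‖v n j x‖ ^ 2 = uFactorr n j x := by
  have h : (((‖v n j (x : ℂ)‖ ^ 2 : ℝ)) : ℂ) = ((uFactorr n j x : ℝ) : ℂ) := by
    rw [← uFactor_ofReal, ← vb_mul_v_eq_uFactor n j hn hj x hx, ← conj_v]
    push_cast
    exact (Complex.conj_mul' _).symm
  exact_mod_cast h

/-- `e^{i(x+2πj)t∕N} · conj e^{i(x+2πj′)t∕N} = (e^{2πi(j−j′)∕N})^t` for real `x`. [folklore] -/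
theorem ef_mul_conj_ef (n j j' t : ℕ) (x : ℝ) :
    ef n j t x * conj (ef n j' t x) = cexp (2 * π * I * ((j : ℂ) - j') / n) ^ t := by
  have h1 : ∀ i : ℕ, I * ((x : ℂ) + 2 * π * i) * t / n = ((((x + 2 * π * i) * t / n : ℝ)) : ℂ) * I := fun i => by
    push_cast; ring
  unfold ef
  rw [h1 j, h1 j', ← Complex.exp_conj, map_mul, Complex.conj_ofReal, Complex.conj_I, ← Complex.exp_add,
    ← Complex.exp_nat_mul]
  congr 1
  push_cast; ring

/-- **Offset orthogonality in one coordinate**: `Σ_{t<N} e^{i(x+2πj)t∕N} conj(e^{i(x+2πj′)t∕N}) = N` if `j = j′`, `= 0` otherwise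
(`j, j′ < N`). [folklore] -/
theorem sum_ef_mul_conj_ef (n : ℕ) (hn : n ≠ 0) {j j' : ℕ} (hj : j < n) (hj' : j' < n) (x : ℝ) :
    ∑ t : Fin n, ef n j (t : ℕ) x * conj (ef n j' (t : ℕ) x) = if j = j' then (n : ℂ) else 0 := by
  rw [Fin.sum_univ_eq_sum_range (fun t => ef n j t x * conj (ef n j' t x)) n]
  simp_rw [ef_mul_conj_ef]
  rw [sum_rootOfUnity_pow n j j' hn hj hj']
  by_cases h : j = j'
  · rw [if_pos h, if_pos h.symm]
  · rw [if_neg h, if_neg (Ne.symm h)]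

/-! ## §2. All coordinates: Parseval over the `N^d` block offsets -/

/-- `Σ_τ Φ_k(τ) conj Φ_{k′}(τ) = N^d·[k = k′]` for the offset characters `Φ_k(τ) = Π_ν e^{i(p_ν+2πk_ν)τ_ν∕N}`. [folklore] -/
theorem sum_offsetPhase_mul_conj (N : ℕ) [NeZero N] (k k' : Fin d → Fin N) (p : Fin d → ℝ) :
    ∑ τ : Fin d → Fin N, (∏ ν, ef N (k ν : ℕ) (τ ν : ℕ) (p ν)) * conj (∏ ν, ef N (k' ν : ℕ) (τ ν : ℕ) (p ν))
      = if k = k' then ((N : ℂ) ^ d) else 0 := by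
  have hN : N ≠ 0 := NeZero.ne N
  have h1 : ∀ τ : Fin d → Fin N, (∏ ν, ef N (k ν : ℕ) (τ ν : ℕ) (p ν)) * conj (∏ ν, ef N (k' ν : ℕ) (τ ν : ℕ) (p ν))
      = ∏ ν, (ef N (k ν : ℕ) (τ ν : ℕ) (p ν) * conj (ef N (k' ν : ℕ) (τ ν : ℕ) (p ν))) := fun τ => by
    rw [map_prod, ← Finset.prod_mul_distrib]
  simp_rw [h1]
  have h := Finset.prod_univ_sum (fun _ : Fin d => (Finset.univ : Finset (Fin N)))
    (fun ν t => ef N (k ν : ℕ) (t : ℕ) (p ν) * conj (ef N (k' ν : ℕ) (t : ℕ) (p ν)))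
  rw [Fintype.piFinset_univ] at h
  rw [← h]
  simp_rw [sum_ef_mul_conj_ef N hN (Fin.isLt _) (Fin.isLt _)]
  by_cases hk : k = k'
  · subst hk
    simp
  · rw [if_neg hk]
    obtain ⟨ν, hν⟩ := Function.ne_iff.mp hk
    exact Finset.prod_eq_zero (Finset.mem_univ ν) (by
      rw [if_neg (fun h => hν (Fin.ext h))])

/-- **PARSEVAL OVER THE BLOCK OFFSETS**: `Σ_τ ‖Σ_k c_k Φ_k(τ)‖² = N^d Σ_k ‖c_k‖²` for arbitrary coefficients `c_k` (the offset
characters are an orthogonal basis of `ℓ²((ℤ∕N)^d)` with square norm `N^d`). [folklore] -/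
theorem offset_parseval (N : ℕ) [NeZero N] (c : (Fin d → Fin N) → ℂ) (p : Fin d → ℝ) :
    ∑ τ : Fin d → Fin N, ‖∑ k : Fin d → Fin N, c k * ∏ ν, ef N (k ν : ℕ) (τ ν : ℕ) (p ν)‖ ^ 2
      = (N : ℝ) ^ d * ∑ k : Fin d → Fin N, ‖c k‖ ^ 2 := by
  set Φ : (Fin d → Fin N) → (Fin d → Fin N) → ℂ := fun k τ => ∏ ν, ef N (k ν : ℕ) (τ ν : ℕ) (p ν) with hΦ
  have key : ∑ τ : Fin d → Fin N, (∑ k, c k * Φ k τ) * conj (∑ k, c k * Φ k τ)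
      = ((N : ℂ) ^ d) * ∑ k, c k * conj (c k) := by
    have h2 : ∀ τ : Fin d → Fin N, (∑ k, c k * Φ k τ) * conj (∑ k, c k * Φ k τ)
        = ∑ k, ∑ k', c k * conj (c k') * (Φ k τ * conj (Φ k' τ)) := fun τ => by
      rw [map_sum, Finset.sum_mul_sum]
      refine Finset.sum_congr rfl fun k _ => Finset.sum_congr rfl fun k' _ => ?_
      rw [map_mul]; ring
    simp_rw [h2]
    rw [Finset.sum_comm]
    have h3 : ∀ k : Fin d → Fin N, ∑ τ : Fin d → Fin N, ∑ k', c k * conj (c k') * (Φ k τ * conj (Φ k' τ))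
        = c k * conj (c k) * (N : ℂ) ^ d := fun k => by
      rw [Finset.sum_comm]
      simp_rw [← Finset.mul_sum]
      simp only [hΦ]
      simp_rw [sum_offsetPhase_mul_conj N k _ p]
      simp
    simp_rw [h3]
    rw [Finset.mul_sum]
    exact Finset.sum_congr rfl fun k _ => by ring
  have hR : (((∑ τ : Fin d → Fin N, ‖∑ k, c k * Φ k τ‖ ^ 2 : ℝ)) : ℂ)
      = ((((N : ℝ) ^ d * ∑ k, ‖c k‖ ^ 2 : ℝ)) : ℂ) := by
    push_cast
    simp_rw [← Complex.mul_conj']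
    exact key
  exact_mod_cast hR

/-! ## §3. The fibre sum of the (2.48) multipliers over the offsets -/

/-- `‖V_N(k;p)‖² = Ur N k p = |u_j(p′+2πk)|²` on the zone. [folklore] -/
theorem norm_V_sq (N : ℕ) [NeZero N] (hN : 1 ≤ N) (k : Fin d → Fin N) (p : Fin d → ℝ) (hp : p ∈ BZ d) :
    ‖V N k (ofRealVec p)‖ ^ 2 = Ur N k p := by
  unfold V Ur
  rw [norm_prod, ← Finset.prod_pow]
  exact Finset.prod_congr rfl fun ν _ => norm_v_sq N (k ν) hN (k ν).isLt (p ν) (abs_le.mpr ⟨hp.1 ν, hp.2 ν⟩)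

/-- the numerator `F_τ(k;p)` factors as offset character times `V`: `F = Φ_k(τ)·V_k`. [folklore] -/
theorem F_eq_phase_mul_V (N : ℕ) (τ k : Fin d → Fin N) (P : Fin d → ℂ) :
    F N τ k P = (∏ ν, ef N (k ν : ℕ) (τ ν : ℕ) (P ν)) * V N k P := by
  unfold F V
  rw [← Finset.prod_mul_distrib]

/-- `E > 0` on the zone (`a > 0`, `N ≥ 1`, `m² = 0`). [folklore] -/
theorem Er_pos (N : ℕ) [NeZero N] (hN : 1 ≤ N) {a : ℝ} (ha : 0 < a) (p : Fin d → ℝ) (hp : p ∈ BZ d) :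
    0 < Er N a 0 p :=
  lt_of_lt_of_le (by positivity) (Er_ge N hN a 0 ha.le le_rfl p fun μ => abs_le.mpr ⟨hp.1 μ, hp.2 μ⟩)

/-- **THE FIBRE SUM**: `Σ_τ ‖G_{N,a,0,τ}(p)‖² = N^d · (Σ_k U_k(p) R_k(p)²) ∕ E(p)²` on the zone — Parseval over the offsets applied
to `G_τ = Σ_k Φ_k(τ)·(V_kR_k∕E)`. [folklore] -/
theorem sum_normSq_G (N : ℕ) [NeZero N] (hN : 1 ≤ N) (a : ℝ) (p : Fin d → ℝ) (hp : p ∈ BZ d) :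
    ∑ τ : Fin d → Fin N, ‖G N a 0 τ (ofRealVec p)‖ ^ 2
      = (N : ℝ) ^ d * (∑ k : Fin d → Fin N, Ur N k p * Rr N k p ^ 2) / Er N a 0 p ^ 2 := by
  set c : (Fin d → Fin N) → ℂ := fun k => V N k (ofRealVec p) * R N 0 k (ofRealVec p) / E N a 0 (ofRealVec p)
    with hc
  have hG : ∀ τ : Fin d → Fin N, G N a 0 τ (ofRealVec p)
      = ∑ k : Fin d → Fin N, c k * ∏ ν, ef N (k ν : ℕ) (τ ν : ℕ) (p ν) := fun τ => by
    unfold G term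
    refine Finset.sum_congr rfl fun k _ => ?_
    rw [F_eq_phase_mul_V, hc]
    simp only [ofRealVec]
    ring
  simp_rw [hG]
  rw [offset_parseval N c p, mul_div_assoc]
  congr 1
  rw [Finset.sum_div]
  refine Finset.sum_congr rfl fun k _ => ?_
  rw [hc]
  simp only
  rw [norm_div, norm_mul, div_pow, mul_pow, norm_V_sq N hN k p hp, R_ofReal, E_ofReal, Complex.norm_real,
    Complex.norm_real, Real.norm_eq_abs, Real.norm_eq_abs, sq_abs, sq_abs]

/-! ## §4. The central alias has the smallest `Δ^ξ`: `R_k ≤ 1` on the zone -/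

/-- `sin² ((x + 2πj)∕2N) ≥ sin²(x∕2N)` for `|x| ≤ π` and `1 ≤ j ≤ N − 1`: the shifted half-angle lies in `[π∕2N, π − π∕2N]`, where
`sin ≥ sin(π∕2N) ≥ |sin(x∕2N)|`. [folklore] -/
theorem sin_sq_shift_ge (N j : ℕ) (hj1 : 1 ≤ j) (hjN : j + 1 ≤ N) (x : ℝ) (hx : |x| ≤ π) :
    Real.sin (x / (2 * N)) ^ 2 ≤ Real.sin ((x + 2 * π * j) / (2 * N)) ^ 2 := by
  have hπ : 0 < π := Real.pi_pos
  have hN : (1 : ℝ) ≤ N := by exact_mod_cast (le_trans (by omega : 1 ≤ j + 1) hjN)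
  have hN0 : (0 : ℝ) < N := by linarith
  have hj1' : (1 : ℝ) ≤ j := by exact_mod_cast hj1
  have hjN' : (j : ℝ) + 1 ≤ N := by exact_mod_cast hjN
  set m : ℝ := π / (2 * N) with hm
  have hm0 : 0 < m := by positivity
  have hmle : m ≤ π / 2 := by
    rw [hm, div_le_div_iff₀ (by positivity) (by norm_num : (0:ℝ) < 2)]
    nlinarith
  set θ : ℝ := (x + 2 * π * j) / (2 * N) with hθ
  have hxl : -π ≤ x := (abs_le.mp hx).1
  have hxu : x ≤ π := (abs_le.mp hx).2
  -- `m ≤ θ ≤ π − m`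
  have hθ1 : m ≤ θ := by
    rw [hm, hθ]
    refine div_le_div_of_nonneg_right ?_ (by positivity)
    nlinarith
  have hθ2 : θ ≤ π - m := by
    have e : π - m = (2 * π * N - π) / (2 * N) := by
      rw [hm]
      field_simp
    rw [e, hθ]
    refine div_le_div_of_nonneg_right ?_ (by positivity)
    nlinarith
  -- `sin m ≤ sin θ`
  have hsm0 : 0 ≤ Real.sin m := Real.sin_nonneg_of_nonneg_of_le_pi hm0.le (by linarith)
  have hB : Real.sin m ≤ Real.sin θ := by
    rcases le_or_gt θ (π / 2) with hc | hc
    · exact Real.sin_le_sin_of_le_of_le_pi_div_two (by linarith) hc hθ1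
    · rw [← Real.sin_pi_sub θ]
      exact Real.sin_le_sin_of_le_of_le_pi_div_two (by linarith) (by linarith) (by linarith)
  -- `|sin(x∕2N)| ≤ sin m`
  set α : ℝ := x / (2 * N) with hα
  have hαm : |α| ≤ m := by
    rw [hα, hm, abs_div, abs_of_pos (by positivity : (0:ℝ) < 2 * N)]
    exact div_le_div_of_nonneg_right hx (by positivity)
  have hA : |Real.sin α| ≤ Real.sin m := by
    rw [Real.abs_sin_eq_sin_abs_of_abs_le_pi (by linarith [abs_nonneg α])]
    exact Real.sin_le_sin_of_le_of_le_pi_div_two (by linarith [abs_nonneg α]) hmle hαm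
  calc Real.sin α ^ 2 = |Real.sin α| ^ 2 := (sq_abs _).symm
    _ ≤ Real.sin m ^ 2 := pow_le_pow_left₀ (abs_nonneg _) hA 2
    _ ≤ Real.sin θ ^ 2 := pow_le_pow_left₀ hsm0 hB 2

/-- `S_ξ(x + 2πj) ≥ S_ξ(x)` for `|x| ≤ π`, `j < N` (`S_ξ(y) = 4N² sin²(y∕2N)`): among the aliases `x + 2πj` of a zone momentum the
central one has the smallest Laplacian symbol. [folklore] -/
theorem Sxir_shift_ge (N j : ℕ) (hjN : j < N) (x : ℝ) (hx : |x| ≤ π) :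
    Sxir N x ≤ Sxir N (x + 2 * π * j) := by
  rcases Nat.eq_zero_or_pos j with h0 | hj
  · subst h0; simp
  · rw [Sxir_eq, Sxir_eq]
    have e1 : x / (2 * (N : ℝ)) = x / (2 * N) := rfl
    refine mul_le_mul_of_nonneg_left ?_ (by positivity)
    exact sin_sq_shift_ge N j hj (by omega) x hx

/-- `Δ^ξ(p) ≤ Δ^ξ(p + 2πk)` on the zone (coordinatewise `Sxir_shift_ge`). [folklore] -/
theorem DeltaXir_le_shift (N : ℕ) (k : Fin d → Fin N) (p : Fin d → ℝ) (hp : p ∈ BZ d) :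
    DeltaXir N 0 p ≤ DeltaXir N 0 (shiftr N k p) := by
  unfold DeltaXir shiftr
  rw [add_zero, add_zero]
  exact Finset.sum_le_sum fun μ _ => Sxir_shift_ge N (k μ) (k μ).isLt (p μ) (abs_le.mpr ⟨hp.1 μ, hp.2 μ⟩)

/-- **`R_k(p) ≤ 1` on the zone** (`R_0 = 1`, `R_k = Δ^ξ(p)∕Δ^ξ(p+2πk)` for `k ≠ 0`): step (2) of CLAIM C-ne7bp1-g111-1 — the central
alias carries the largest `X = 1∕Δ^ξ`. [folklore] -/
theorem Rr_le_one (N : ℕ) [NeZero N] (k : Fin d → Fin N) (p : Fin d → ℝ) (hp : p ∈ BZ d) : Rr N k p ≤ 1 := by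
  unfold Rr
  split_ifs with h
  · exact le_rfl
  · exact div_le_one_of_le₀ (DeltaXir_le_shift N k p hp) (B4Strip.DeltaXir_nonneg N 0 le_rfl _)

/-- `R_0 = 1`. [folklore] -/
theorem Rr_zero (N : ℕ) [NeZero N] (p : Fin d → ℝ) : Rr N (fun _ => (0 : Fin N)) p = 1 := by
  unfold Rr; rw [if_pos rfl]

/-! ## §5. The fibre bound for the tree's letters and the headline -/

/-- **`Σ_k U_k R_k² ≤ (π²∕4)^d · X²`** on the zone (`X = Σ_k U_kR_k`): (39) `fibre_bound` with the central index `k = 0`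
(`R ≤ 1 = R_0`, `U_0 ≥ (4∕π²)^d` = `B4Strip.Ur_zero_ge`). [folklore] -/
theorem sum_Ur_mul_Rr_sq_le (N : ℕ) [NeZero N] (hN : 1 ≤ N) (p : Fin d → ℝ) (hp : p ∈ BZ d) :
    ∑ k : Fin d → Fin N, Ur N k p * Rr N k p ^ 2 ≤ (π ^ 2 / 4) ^ d * Xr N p ^ 2 := by
  have hπ : 0 < π := Real.pi_pos
  have hfb := fibre_bound (d := d) (fun k => Ur N k p) (fun k => Rr N k p) (fun k => Ur_nonneg N k p)
    (fun k => Rr_nonneg N k p) (fun _ => (0 : Fin N)) (fun k => by rw [Rr_zero]; exact Rr_le_one N k p hp)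
    (Ur_zero_ge N hN p fun μ => abs_le.mpr ⟨hp.1 μ, hp.2 μ⟩)
  -- `hfb : (4/π²)^d * Σ U R² ≤ (Σ U R)² = X²`
  have hX : (∑ k : Fin d → Fin N, Ur N k p * Rr N k p) = Xr N p := rfl
  rw [hX] at hfb
  have hc : (π ^ 2 / 4) ^ d * (4 / π ^ 2) ^ d = 1 := by
    rw [← mul_pow]
    have h1 : π ^ 2 / 4 * (4 / π ^ 2) = 1 := by field_simp
    rw [h1, one_pow]
  calc ∑ k : Fin d → Fin N, Ur N k p * Rr N k p ^ 2
      = (π ^ 2 / 4) ^ d * ((4 / π ^ 2) ^ d * ∑ k : Fin d → Fin N, Ur N k p * Rr N k p ^ 2) := by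
        rw [← mul_assoc, hc, one_mul]
    _ ≤ (π ^ 2 / 4) ^ d * Xr N p ^ 2 := mul_le_mul_of_nonneg_left hfb (by positivity)

/-- `symbR = X∕E` (`E = aX + Δ₀`). [folklore] -/
theorem symbR_eq_div (N : ℕ) [NeZero N] (a : ℝ) (p : Fin d → ℝ) : symbR N a p = Xr N p / Er N a 0 p := by
  unfold symbR; rw [Er_eq]

/-- **THE HEADLINE — the multiplier of `M^{−d}‖G′Q′*ω‖²_η` summed over the block is at most `(π²∕4)^d` times the square of the
`Q′G′Q′*` multiplier**: `Σ_τ ‖G_{N,a,0,τ}(p)‖² ≤ N^d (π²∕4)^d · symbR_{N,a}(p)²` on the real zone, every block side `N ≥ 1`, every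
`a > 0`.  With the fibre formula this is `S₂∕S² ≤ (π²∕4)^d`, i.e. `‖H_M‖_η ≤ (π∕2)^d` (CLAIM C-ne7bp1-g111-1). [folklore] -/
theorem sum_normSq_G_le (N : ℕ) [NeZero N] (hN : 1 ≤ N) {a : ℝ} (ha : 0 < a) (p : Fin d → ℝ) (hp : p ∈ BZ d) :
    ∑ τ : Fin d → Fin N, ‖G N a 0 τ (ofRealVec p)‖ ^ 2 ≤ (N : ℝ) ^ d * (π ^ 2 / 4) ^ d * symbR N a p ^ 2 := by
  rw [sum_normSq_G N hN a p hp, symbR_eq_div]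
  have hE : 0 < Er N a 0 p ^ 2 := pow_pos (Er_pos N hN ha p hp) 2
  have h1 : (∑ k : Fin d → Fin N, Ur N k p * Rr N k p ^ 2) / Er N a 0 p ^ 2
      ≤ (π ^ 2 / 4) ^ d * Xr N p ^ 2 / Er N a 0 p ^ 2 :=
    div_le_div_of_nonneg_right (sum_Ur_mul_Rr_sq_le N hN p hp) hE.le
  calc (N : ℝ) ^ d * (∑ k : Fin d → Fin N, Ur N k p * Rr N k p ^ 2) / Er N a 0 p ^ 2
      = (N : ℝ) ^ d * ((∑ k : Fin d → Fin N, Ur N k p * Rr N k p ^ 2) / Er N a 0 p ^ 2) := mul_div_assoc _ _ _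
    _ ≤ (N : ℝ) ^ d * ((π ^ 2 / 4) ^ d * Xr N p ^ 2 / Er N a 0 p ^ 2) := mul_le_mul_of_nonneg_left h1 (by positivity)
    _ = (N : ℝ) ^ d * (π ^ 2 / 4) ^ d * (Xr N p / Er N a 0 p) ^ 2 := by rw [div_pow]; ring

end

end Summit.QuantumFields.BalabanUV.T4Continuum.NE7b.OneShotChartFibreSum
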